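import Mathlib
import Summits.PneNP.PneNP.Theorems.CnfIdealGenLengthRankDefectRepresentationsCutLemmaMaxCut

/-!
# Crux `RankDefectRepresentations` (stmt-PneNP-18923), line `rank-dehn-ladder`: SUBADDITIVITY OF MAX-CUT DROPS
# (lead g15 helper H4; memo `Cruxes/RankDefectRepresentations/Lines/rank-dehn-ladder-g15.md` §5, briefs `…-briefs-g15b.md` §H4)

For a matrix `M` whose rows and columns carry colours in `Q`, the ONE-FAMILY MAX-CUT VALUE is
`maxCut M = max_{B′ ⊆ Q} [rank M|_{(row∈B′)×(col∉B′)} + rank M|_{(row∉B′)×(col∈B′)}]` (`maxCut`, `cutValue`; the `ν`-surrogate of the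
memo).  This file proves the ACCOUNTING HALF of a two-dimensional "Theorem 2" (max-cut decomposition): for any second labelling
`cls : rows → Fin k`, the drops of the max-cut value under zeroing one row class at a time add up below the max-cut value,
`∑ i (maxCut M − maxCut M_{−i}) ≤ maxCut M` (`sum_maxCut_sub_le`).  Proof: at a colour set `B′*` attaining the maximum for `M`, the
`i`-th drop is at most the drop of the cut value AT `B′*` (`cutValue_le_maxCut`), i.e. the sum of the rank drops of the two honest cut
blocks under zeroing the class-`i` rows; and for a fixed matrix the rank drops under deleting disjoint row classes are private
dimensions, which add up below the rank (`sum_rank_sub_rowClass_le`, from `…CutLemmaMaxCut.sum_rank_sub_erase_le`).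
Also: `maxCut` is monotone under zeroing rows (`maxCut_rowZero_le`, `maxCut_rowClass_le`).
HONEST FRAMING: elementary linear algebra, a bookkeeping helper for the lead's budget lane; the LIFT half (coherent filling of the
invisible cells, SIMCORR) is the open part; the crux stays open; P ≠ NP is not moved; F-N2 is a FRONTIER formal rung.
-/

set_option linter.dupNamespace false -- `Summit.PneNP.PneNP.…`: summit = sub-problem name (D-0017)

namespace Summit.PneNP.PneNP.Theorems.CnfIdealGenLengthRankDefectRepresentationsMaxCutDrops

open Finset Matrix
open Summit.PneNP.PneNP.Theorems.CnfIdealGenLengthRankDefectRepresentationsCutLemmaMaxCut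
  (sum_rank_sub_erase_le rank_rowZero_le)

/-- The one-family max-cut value of a matrix with coloured rows and columns: the maximum over colour sets `B′` of
`rank M|_{(row∈B′)×(col∉B′)} + rank M|_{(row∉B′)×(col∈B′)}`. -/
noncomputable def maxCut {ι ι' Q K : Type} [Field K] [Fintype ι] [Fintype ι'] [Fintype Q] [DecidableEq Q]
    (rowc : ι → Q) (colc : ι' → Q) (M : Matrix ι ι' K) : ℕ :=
  Finset.univ.sup fun B' : Finset Q =>
    (Matrix.of fun x y => if rowc x ∈ B' ∧ colc y ∉ B' then M x y else 0).rank +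
    (Matrix.of fun x y => if rowc x ∉ B' ∧ colc y ∈ B' then M x y else 0).rank

/-- The cut value of `M` at the colour set `B′`: `rank M|_{(row∈B′)×(col∉B′)} + rank M|_{(row∉B′)×(col∈B′)}`
(so that `maxCut` is its maximum over `B′`, `maxCut_eq_sup_cutValue`). -/
noncomputable def cutValue {ι ι' Q K : Type} [Field K] [Fintype ι] [Fintype ι'] [DecidableEq Q]
    (rowc : ι → Q) (colc : ι' → Q) (M : Matrix ι ι' K) (B' : Finset Q) : ℕ :=
  (Matrix.of fun x y => if rowc x ∈ B' ∧ colc y ∉ B' then M x y else 0).rank +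
    (Matrix.of fun x y => if rowc x ∉ B' ∧ colc y ∈ B' then M x y else 0).rank

section MaxCut

variable {ι ι' Q K : Type} [Field K] [Fintype ι] [Fintype ι'] [Fintype Q] [DecidableEq Q]
  (rowc : ι → Q) (colc : ι' → Q) (M : Matrix ι ι' K)

/-- `maxCut` is the maximum of the cut values over all colour sets. -/
theorem maxCut_eq_sup_cutValue : maxCut rowc colc M = Finset.univ.sup (cutValue rowc colc M) := rfl

/-- Every cut value is at most the max-cut value. -/
theorem cutValue_le_maxCut (B' : Finset Q) : cutValue rowc colc M B' ≤ maxCut rowc colc M :=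
  Finset.le_sup (f := cutValue rowc colc M) (Finset.mem_univ B')

/-- The max-cut value is attained at some colour set. -/
theorem exists_maxCut_eq : ∃ B' : Finset Q, maxCut rowc colc M = cutValue rowc colc M B' := by
  obtain ⟨B', -, h⟩ :=
    Finset.exists_mem_eq_sup (Finset.univ : Finset (Finset Q)) ⟨∅, Finset.mem_univ _⟩ (cutValue rowc colc M)
  exact ⟨B', h⟩

/-- `maxCut M ≤ m` iff every cut value is `≤ m`. -/
theorem maxCut_le_iff {m : ℕ} : maxCut rowc colc M ≤ m ↔ ∀ B' : Finset Q, cutValue rowc colc M B' ≤ m := by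
  rw [maxCut_eq_sup_cutValue, Finset.sup_le_iff]
  exact ⟨fun h B' => h B' (Finset.mem_univ _), fun h B' _ => h B'⟩

omit [Fintype ι] [Fintype ι'] [Fintype Q] in
/-- Zeroing rows commutes with the cut masks: the first cut block of the row-zeroed matrix is the row-zeroed first cut block. -/
theorem mask₁_rowZero (p : ι → Prop) [DecidablePred p] (B' : Finset Q) :
    (Matrix.of fun x y => if rowc x ∈ B' ∧ colc y ∉ B' then
        (Matrix.of fun x y => if p x then M x y else (0 : K)) x y else 0) =
      Matrix.of fun x y => if p x then
        (Matrix.of fun x y => if rowc x ∈ B' ∧ colc y ∉ B' then M x y else (0 : K)) x y else 0 := by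
  ext x y
  simp only [Matrix.of_apply]
  split_ifs <;> rfl

omit [Fintype ι] [Fintype ι'] [Fintype Q] in
/-- Zeroing rows commutes with the cut masks: the second cut block of the row-zeroed matrix is the row-zeroed second cut block. -/
theorem mask₂_rowZero (p : ι → Prop) [DecidablePred p] (B' : Finset Q) :
    (Matrix.of fun x y => if rowc x ∉ B' ∧ colc y ∈ B' then
        (Matrix.of fun x y => if p x then M x y else (0 : K)) x y else 0) =
      Matrix.of fun x y => if p x then
        (Matrix.of fun x y => if rowc x ∉ B' ∧ colc y ∈ B' then M x y else (0 : K)) x y else 0 := by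
  ext x y
  simp only [Matrix.of_apply]
  split_ifs <;> rfl

omit [Fintype Q] in
/-- Zeroing rows does not increase any cut value. -/
theorem cutValue_rowZero_le (p : ι → Prop) [DecidablePred p] (B' : Finset Q) :
    cutValue rowc colc (Matrix.of fun x y => if p x then M x y else 0) B' ≤ cutValue rowc colc M B' := by
  classical
  unfold cutValue
  rw [mask₁_rowZero, mask₂_rowZero]
  exact Nat.add_le_add (rank_rowZero_le _ _) (rank_rowZero_le _ _)

/-- Zeroing rows does not increase the max-cut value. -/
theorem maxCut_rowZero_le (p : ι → Prop) [DecidablePred p] :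
    maxCut rowc colc (Matrix.of fun x y => if p x then M x y else 0) ≤ maxCut rowc colc M :=
  (maxCut_le_iff rowc colc _).mpr fun B' =>
    (cutValue_rowZero_le rowc colc M p B').trans (cutValue_le_maxCut rowc colc M B')

omit [Fintype ι] [Fintype ι'] [Fintype Q] [DecidableEq Q] in
/-- Zeroing the rows of one class of a labelling `cls`, written as `if cls x = i then 0 else M x y`, is row-zeroing for the
predicate `cls x ≠ i`. -/
theorem rowClassZero_eq {k : ℕ} (cls : ι → Fin k) (i : Fin k) :
    (Matrix.of fun x y => if cls x = i then (0 : K) else M x y) =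
      Matrix.of fun x y => if cls x ≠ i then M x y else 0 := by
  ext x y
  simp only [Matrix.of_apply, ne_eq, ite_not]

/-- Zeroing the rows of one class does not increase the max-cut value (so the subtraction in `sum_maxCut_sub_le` is honest). -/
theorem maxCut_rowClass_le {k : ℕ} (cls : ι → Fin k) (i : Fin k) :
    maxCut rowc colc (Matrix.of fun x y => if cls x = i then 0 else M x y) ≤ maxCut rowc colc M := by
  rw [rowClassZero_eq]
  exact maxCut_rowZero_le rowc colc M _

end MaxCut

/-- **Private dimensions of a row partition add up below the rank**: for a labelling `cls` of the rows of `N` by `Fin k`,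
`∑ i (rank N − rank N_{−i}) ≤ rank N`, where `N_{−i}` is `N` with the rows of class `i` zeroed (each drop is the dimension of
the row space of `N` modulo the span of the other classes' rows, and these private parts are independent).
Instance of `…CutLemmaMaxCut.sum_rank_sub_erase_le` with `B = C = univ`. -/
theorem sum_rank_sub_rowClass_le {ι ι' K : Type} [Field K] [Fintype ι] [Fintype ι'] (N : Matrix ι ι' K) {k : ℕ}
    (cls : ι → Fin k) :
    ∑ i : Fin k, (N.rank - (Matrix.of fun x y => if cls x = i then 0 else N x y).rank) ≤ N.rank := by
  classical
  have main := sum_rank_sub_erase_le (K := K) cls N Finset.univ Finset.univ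
  have hU : (Matrix.of fun z y => if cls z ∈ (Finset.univ : Finset (Fin k)) then N z y else 0) = N := by
    ext z y; simp
  have h0 : (Matrix.of fun z y =>
      if cls z ∈ (Finset.univ : Finset (Fin k)) \ Finset.univ then N z y else 0) = 0 := by
    ext z y; simp
  have hE : ∀ i : Fin k, (Matrix.of fun z y => if cls z ∈ (Finset.univ : Finset (Fin k)).erase i then N z y else 0) =
      Matrix.of fun x y => if cls x = i then 0 else N x y := by
    intro i; ext x y
    simp only [Matrix.of_apply, Finset.mem_erase, Finset.mem_univ, and_true, ne_eq, ite_not]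
  simp only [hU, h0, hE, Matrix.rank_zero, Nat.cast_zero, add_zero] at main
  have hle : ∀ i : Fin k, (Matrix.of fun x y => if cls x = i then 0 else N x y).rank ≤ N.rank := by
    intro i
    rw [← hE i]
    exact rank_rowZero_le _ _
  have hcast : ∀ i : Fin k,
      (((N.rank - (Matrix.of fun x y => if cls x = i then 0 else N x y).rank : ℕ)) : ℤ) =
        (N.rank : ℤ) - ((Matrix.of fun x y => if cls x = i then 0 else N x y).rank : ℤ) :=
    fun i => Nat.cast_sub (hle i)
  have h : ((∑ i : Fin k, (N.rank - (Matrix.of fun x y => if cls x = i then 0 else N x y).rank) : ℕ) : ℤ) ≤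
      (N.rank : ℤ) := by
    rw [Nat.cast_sum]
    simp only [hcast]
    exact main
  exact_mod_cast h

/-- **Drops of the cut value at a FIXED colour set add up below the cut value**: for every `B′` and every row labelling `cls`,
`∑ i (cutValue M B′ − cutValue M_{−i} B′) ≤ cutValue M B′` — the two cut blocks of `M_{−i}` at `B′` are the row-zeroed cut blocks of
`M`, and `sum_rank_sub_rowClass_le` applies to each block. -/
theorem sum_cutValue_sub_le {ι ι' Q K : Type} [Field K] [Fintype ι] [Fintype ι'] [DecidableEq Q]
    (rowc : ι → Q) (colc : ι' → Q) (M : Matrix ι ι' K) (B' : Finset Q) {k : ℕ} (cls : ι → Fin k) :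
    ∑ i : Fin k, (cutValue rowc colc M B' -
        cutValue rowc colc (Matrix.of fun x y => if cls x = i then 0 else M x y) B') ≤ cutValue rowc colc M B' := by
  classical
  -- the cut blocks of `M_{−i}` are the row-zeroed cut blocks of `M`
  have hcv : ∀ i : Fin k, cutValue rowc colc (Matrix.of fun x y => if cls x = i then 0 else M x y) B' =
      (Matrix.of fun x y => if cls x = i then 0 else
          (Matrix.of fun x y => if rowc x ∈ B' ∧ colc y ∉ B' then M x y else (0 : K)) x y).rank +
        (Matrix.of fun x y => if cls x = i then 0 else
          (Matrix.of fun x y => if rowc x ∉ B' ∧ colc y ∈ B' then M x y else (0 : K)) x y).rank := by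
    intro i
    have e1 : (Matrix.of fun x y => if rowc x ∈ B' ∧ colc y ∉ B' then
        (Matrix.of fun x y => if cls x = i then (0 : K) else M x y) x y else 0) =
        Matrix.of fun x y => if cls x = i then 0 else
          (Matrix.of fun x y => if rowc x ∈ B' ∧ colc y ∉ B' then M x y else (0 : K)) x y := by
      ext x y; simp only [Matrix.of_apply]; split_ifs <;> rfl
    have e2 : (Matrix.of fun x y => if rowc x ∉ B' ∧ colc y ∈ B' then
        (Matrix.of fun x y => if cls x = i then (0 : K) else M x y) x y else 0) =
        Matrix.of fun x y => if cls x = i then 0 else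
          (Matrix.of fun x y => if rowc x ∉ B' ∧ colc y ∈ B' then M x y else (0 : K)) x y := by
      ext x y; simp only [Matrix.of_apply]; split_ifs <;> rfl
    unfold cutValue
    rw [e1, e2]
  simp only [hcv]
  unfold cutValue
  set A : Matrix ι ι' K := Matrix.of fun x y => if rowc x ∈ B' ∧ colc y ∉ B' then M x y else 0 with hA
  set A' : Matrix ι ι' K := Matrix.of fun x y => if rowc x ∉ B' ∧ colc y ∈ B' then M x y else 0 with hA'
  have h1 := sum_rank_sub_rowClass_le A cls
  have h2 := sum_rank_sub_rowClass_le A' cls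
  have m1 : ∀ i : Fin k, (Matrix.of fun x y => if cls x = i then 0 else A x y).rank ≤ A.rank := by
    intro i
    rw [rowClassZero_eq]
    exact rank_rowZero_le _ _
  have m2 : ∀ i : Fin k, (Matrix.of fun x y => if cls x = i then 0 else A' x y).rank ≤ A'.rank := by
    intro i
    rw [rowClassZero_eq]
    exact rank_rowZero_le _ _
  calc ∑ i : Fin k, (A.rank + A'.rank -
          ((Matrix.of fun x y => if cls x = i then 0 else A x y).rank +
            (Matrix.of fun x y => if cls x = i then 0 else A' x y).rank))
        = ∑ i : Fin k, ((A.rank - (Matrix.of fun x y => if cls x = i then 0 else A x y).rank) +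
            (A'.rank - (Matrix.of fun x y => if cls x = i then 0 else A' x y).rank)) := by
          refine Finset.sum_congr rfl fun i _ => ?_
          have := m1 i
          have := m2 i
          omega
    _ = ∑ i : Fin k, (A.rank - (Matrix.of fun x y => if cls x = i then 0 else A x y).rank) +
          ∑ i : Fin k, (A'.rank - (Matrix.of fun x y => if cls x = i then 0 else A' x y).rank) :=
          Finset.sum_add_distrib
    _ ≤ A.rank + A'.rank := Nat.add_le_add h1 h2

/-- **Max-cut drops under deleting row classes add up below the max-cut** (the accounting half of a 2D Theorem 2, memo g15 §5):
for a second labelling `cls : ι → Fin k` of the rows, `∑ i, (maxCut M − maxCut (M with the rows of class i zeroed)) ≤ maxCut M`.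
Proof: at a colour set `B′*` attaining `maxCut M` the `i`-th drop is at most the drop of the cut value at `B′*`
(`cutValue_le_maxCut` for `M_{−i}`), and those drops add up below `cutValue M B′* = maxCut M` (`sum_cutValue_sub_le`). -/
theorem sum_maxCut_sub_le {ι ι' Q K : Type} [Field K] [Fintype ι] [Fintype ι'] [DecidableEq ι] [DecidableEq ι']
    [Fintype Q] [DecidableEq Q]
    (rowc : ι → Q) (colc : ι' → Q) (M : Matrix ι ι' K) {k : ℕ} (cls : ι → Fin k) :
    ∑ i : Fin k, (maxCut rowc colc M - maxCut rowc colc (Matrix.of fun x y => if cls x = i then 0 else M x y)) ≤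
      maxCut rowc colc M := by
  obtain ⟨B', hB'⟩ := exists_maxCut_eq rowc colc M
  have hterm : ∀ i : Fin k,
      maxCut rowc colc M - maxCut rowc colc (Matrix.of fun x y => if cls x = i then 0 else M x y) ≤
        cutValue rowc colc M B' - cutValue rowc colc (Matrix.of fun x y => if cls x = i then 0 else M x y) B' := by
    intro i
    rw [hB']
    exact Nat.sub_le_sub_left (cutValue_le_maxCut rowc colc _ B') _
  calc ∑ i : Fin k, (maxCut rowc colc M - maxCut rowc colc (Matrix.of fun x y => if cls x = i then 0 else M x y))
      ≤ ∑ i : Fin k, (cutValue rowc colc M B' -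
          cutValue rowc colc (Matrix.of fun x y => if cls x = i then 0 else M x y) B') :=
        Finset.sum_le_sum fun i _ => hterm i
    _ ≤ cutValue rowc colc M B' := sum_cutValue_sub_le rowc colc M B' cls
    _ = maxCut rowc colc M := hB'.symm

end Summit.PneNP.PneNP.Theorems.CnfIdealGenLengthRankDefectRepresentationsMaxCutDrops
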